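import Mathlib
import Literature.NumberTheory.Sieve.LiouvillePolynomialValuesMaxExpSum
import HarnessLib

/-!
# Teräväinen 2024, §5.4: the elementary endgame of the minor-arc case

Support file (everything PROVED; no definitions, no named facts) towards the named fact
`Literature.NumberTheory.Sieve.teravainen2024_cor_2_1` (J. Teräväinen, *On the Liouville function
at polynomial arguments*, Amer. J. Math. 146 (2024) = arXiv:2010.07924, Corollary 2.1 ⊂
Theorem 2.6, proved in §5). In Case 2 (minor arcs) of the proof of Proposition 5.4 (§5.4, p. 15)
the correlation `𝔼_{x≤n≤x+H} g(Qn+a) e(P_x(n))` of a `μ_q`-valued `g` with an equidistributed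
polynomial phase is bounded through the weights
`α(j) = 𝔼_n 1_{g(Qn+a)=e(a/q)} 1_{e(P_x(n)) ∈ [j/J₀,(j+1)/J₀)}`, `0 ≤ j < J₀`, which satisfy
`∑_j α(j) = δ_a` ((5.22)) and, by the Erdős–Turán lemma 5.6, `α(j) ≤ (1 + η')/J₀` ((5.23)); the
paper then combines (5.22), (5.23) with Lemma 5.7 into

> `|∑_{0≤j<J₀} e(j/J₀) α(j)| ≤ ((1+η')/J₀)|∑_{|j|≤δ_a J₀/2} e(j/J₀)| + O(1/J₀)`
> `≤ (1+2η') ∫_{-δ_a/2}^{δ_a/2} e(t) dt + O(η') ≤ (1+3η') sin(πδ_a)/π`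
> "where the error term of `O(1/J₀)` arose from the fact that the sum of the `α(j)` is not
> necessarily an integer",

followed by Jensen's inequality `(1/π)∑_a sin(πδ_a) ≤ (q/π) sin(π/q) = 1 - 2δ`
(`Teravainen2024.sum_sin_pi_mul_le`, `Teravainen2024.div_pi_mul_sin_lt_one` in
`LiouvillePolynomialValuesMaxExpSum.lean`). This file proves that displayed chain with explicit
constants, from Lemma 5.7 (`Teravainen2024.norm_sum_range_weight_mul_exp_le`) and the closed form
`|∑_{i<m} e(i/J)| = sin(πm/J)/sin(π/J)` (`Teravainen2024.norm_sum_range_exp_eq`):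

* `Teravainen2024.norm_sum_weight_mul_exp_le_of_le` — weights `α_j ∈ [0, A]` with total
  `∑ α_j = δ` and `m = ⌊δ/A⌋`: `|∑_{j<J} α_j e(j/J)| ≤ A |∑_{i<m} e(i/J)| + A` (Lemma 5.7 after
  removing the fractional mass `δ/A - m < 1`, the printed "`O(1/J₀)`");
* `Teravainen2024.norm_sum_weight_mul_exp_le_sin` — for `J ≥ 4`, `0 ≤ ε ≤ 1`,
  `α_j ∈ [0, (1+ε)/J]`, `∑_{j<J} α_j = δ ≤ 1`:
  `|∑_{j<J} α_j e(j/J)| ≤ sin(πδ)/π + 4ε + 8/J`.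

## References
* J. Teräväinen, Amer. J. Math. 146 (2024), no. 4, 1115–1167, §5.4, proof of Proposition 5.4,
  Case 2, displays (5.22)–(5.23) and the chain following them (arXiv:2010.07924, p. 15).
  [Teravainen2024]
-/

noncomputable section

open Finset Complex

namespace Literature.NumberTheory.Sieve

namespace Teravainen2024

/-- **Lemma 5.7 with a non-integral total mass** (Teräväinen 2024, §5.4, "the error term of
`O(1/J₀)` arose from the fact that the sum of the `α(j)` is not necessarily an integer"): if
`0 ≤ α_j ≤ A` for `j < J` and `m ≤ (∑_j α_j)/A < m + 1`, then
`|∑_{j<J} α_j e(j/J)| ≤ A·|∑_{i<m} e(i/J)| + A`. [cite: Teravainen2024, §5.4 (proof of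
Proposition 5.4, Case 2)] -/
theorem norm_sum_weight_mul_exp_le_of_le {J : ℕ} (hJ : 0 < J) {A : ℝ} (hA : 0 < A) (α : ℕ → ℝ)
    (h0 : ∀ j < J, 0 ≤ α j) (h1 : ∀ j < J, α j ≤ A) {m : ℕ}
    (hm : (m : ℝ) ≤ (∑ j ∈ range J, α j) / A) (hm1 : (∑ j ∈ range J, α j) / A < m + 1) :
    ‖∑ j ∈ range J, (α j : ℂ) * exp (2 * Real.pi * I * (j : ℂ) / J)‖ ≤
      A * ‖∑ i ∈ range m, exp (2 * Real.pi * I * (i : ℂ) / J)‖ + A := by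
  set δ : ℝ := ∑ j ∈ range J, α j with hδ
  set s : ℝ := δ / A with hs
  have hδ0 : 0 ≤ δ := Finset.sum_nonneg fun j hj => h0 j (Finset.mem_range.mp hj)
  have hs0 : 0 ≤ s := div_nonneg hδ0 hA.le
  -- `s ≤ J`, hence `m ≤ J`
  have hδJ : δ ≤ J * A := by
    calc δ ≤ ∑ j ∈ range J, A := Finset.sum_le_sum fun j hj => h1 j (Finset.mem_range.mp hj)
      _ = J * A := by rw [Finset.sum_const, Finset.card_range, nsmul_eq_mul]
  have hsJ : s ≤ J := by rw [hs, div_le_iff₀ hA]; exact hδJ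
  have hmJ : m ≤ J := by
    have h : (m : ℝ) ≤ J := hm.trans hsJ
    exact_mod_cast h
  -- the normalised weights `w = α/A` and their rescaling `w' = (m/s) w` of total mass `m`
  set w : ℕ → ℝ := fun j => α j / A with hw
  have hw0 : ∀ j < J, 0 ≤ w j := fun j hj => div_nonneg (h0 j hj) hA.le
  have hw1 : ∀ j < J, w j ≤ 1 := fun j hj => by
    rw [hw]
    exact (div_le_one hA).mpr (h1 j hj)
  have hwsum : ∑ j ∈ range J, w j = s := by
    rw [hs, hδ, Finset.sum_div]
  rcases eq_or_lt_of_le hs0 with hs00 | hspos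
  · -- `s = 0`: all weights vanish
    have hw00 : ∀ j ∈ range J, w j = 0 :=
      (Finset.sum_eq_zero_iff_of_nonneg fun j hj => hw0 j (Finset.mem_range.mp hj)).mp
        (by rw [hwsum, ← hs00])
    have hα0 : ∀ j ∈ range J, α j = 0 := fun j hj => by
      have h := hw00 j hj
      rw [hw] at h
      simp only [div_eq_zero_iff, hA.ne', or_false] at h
      exact h
    rw [Finset.sum_eq_zero fun j hj => by rw [hα0 j hj]; simp, norm_zero]
    positivity
  set w' : ℕ → ℝ := fun j => (m / s) * w j with hw'
  have hms : (m : ℝ) / s ≤ 1 := (div_le_one hspos).mpr hm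
  have hms0 : 0 ≤ (m : ℝ) / s := div_nonneg (Nat.cast_nonneg m) hs0
  have hw'0 : ∀ j < J, 0 ≤ w' j := fun j hj => mul_nonneg hms0 (hw0 j hj)
  have hw'le : ∀ j < J, w' j ≤ w j := fun j hj => by
    have h := hw0 j hj
    calc w' j = (m / s) * w j := rfl
      _ ≤ 1 * w j := mul_le_mul_of_nonneg_right hms h
      _ = w j := one_mul _
  have hw'1 : ∀ j < J, w' j ≤ 1 := fun j hj => (hw'le j hj).trans (hw1 j hj)
  have hw'sum : ∑ j ∈ range J, w' j = m := by
    rw [hw']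
    simp only
    rw [← Finset.mul_sum, hwsum]
    field_simp
  -- Lemma 5.7 for `w'`
  have h57 := norm_sum_range_weight_mul_exp_le hJ hmJ w' hw'0 hw'1 hw'sum
  -- the discarded mass
  have hdisc : ‖∑ j ∈ range J, ((w j - w' j : ℝ) : ℂ) * exp (2 * Real.pi * I * (j : ℂ) / J)‖ ≤ 1 := by
    calc ‖∑ j ∈ range J, ((w j - w' j : ℝ) : ℂ) * exp (2 * Real.pi * I * (j : ℂ) / J)‖
        ≤ ∑ j ∈ range J, ‖((w j - w' j : ℝ) : ℂ) * exp (2 * Real.pi * I * (j : ℂ) / J)‖ :=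
          norm_sum_le _ _
      _ = ∑ j ∈ range J, (w j - w' j) := by
          refine Finset.sum_congr rfl fun j hj => ?_
          have hj' := Finset.mem_range.mp hj
          rw [norm_mul, Complex.norm_real, Real.norm_eq_abs,
            abs_of_nonneg (sub_nonneg.mpr (hw'le j hj'))]
          have h : 2 * Real.pi * I * (j : ℂ) / J = ((2 * Real.pi * j / J : ℝ) : ℂ) * I := by
            push_cast
            ring
          rw [h, Complex.norm_exp_ofReal_mul_I, mul_one]
      _ = s - m := by rw [Finset.sum_sub_distrib, hwsum, hw'sum]
      _ ≤ 1 := by linarith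
  -- assemble: `∑ α e = A (∑ w' e + ∑ (w - w') e)`
  have hsplit : ∑ j ∈ range J, (α j : ℂ) * exp (2 * Real.pi * I * (j : ℂ) / J) =
      (A : ℂ) * (∑ j ∈ range J, (w' j : ℂ) * exp (2 * Real.pi * I * (j : ℂ) / J) +
        ∑ j ∈ range J, ((w j - w' j : ℝ) : ℂ) * exp (2 * Real.pi * I * (j : ℂ) / J)) := by
    rw [← Finset.sum_add_distrib, Finset.mul_sum]
    refine Finset.sum_congr rfl fun j _ => ?_
    have hA' : (A : ℂ) ≠ 0 := by exact_mod_cast hA.ne'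
    have h : (α j : ℂ) = (A : ℂ) * (w j : ℂ) := by
      rw [hw]
      push_cast
      field_simp
    rw [h]
    push_cast
    ring
  rw [hsplit, norm_mul, Complex.norm_real, Real.norm_eq_abs, abs_of_pos hA]
  calc A * ‖∑ j ∈ range J, (w' j : ℂ) * exp (2 * Real.pi * I * (j : ℂ) / J) +
        ∑ j ∈ range J, ((w j - w' j : ℝ) : ℂ) * exp (2 * Real.pi * I * (j : ℂ) / J)‖
      ≤ A * (‖∑ j ∈ range J, (w' j : ℂ) * exp (2 * Real.pi * I * (j : ℂ) / J)‖ +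
        ‖∑ j ∈ range J, ((w j - w' j : ℝ) : ℂ) * exp (2 * Real.pi * I * (j : ℂ) / J)‖) :=
        mul_le_mul_of_nonneg_left (norm_add_le _ _) hA.le
    _ ≤ A * (‖∑ i ∈ range m, exp (2 * Real.pi * I * (i : ℂ) / J)‖ + 1) :=
        mul_le_mul_of_nonneg_left (add_le_add h57 hdisc) hA.le
    _ = A * ‖∑ i ∈ range m, exp (2 * Real.pi * I * (i : ℂ) / J)‖ + A := by ring

/-- `J sin(π/J) ≥ π - π³/(6J²)` for `J ≥ 1` (from `sin x > x - x³/6`). [folklore] -/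
theorem pi_sub_le_mul_sin_pi_div {J : ℕ} (hJ : 0 < J) :
    Real.pi - Real.pi ^ 3 / (6 * (J : ℝ) ^ 2) ≤ J * Real.sin (Real.pi / J) := by
  have hJR : (0 : ℝ) < J := by exact_mod_cast hJ
  have h := Real.sin_gt_sub_cube (x := Real.pi / J) (by positivity)
  have h2 : (J : ℝ) * (Real.pi / J - (Real.pi / J) ^ 3 / 6) =
      Real.pi - Real.pi ^ 3 / (6 * (J : ℝ) ^ 2) := by
    field_simp
  rw [← h2]
  exact mul_le_mul_of_nonneg_left h.le hJR.le

/-- `1/(π(1-v)) ≤ (1+2v)/π` for `0 ≤ v ≤ 1/2`. [folklore] -/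
theorem one_div_pi_mul_one_sub_le {v : ℝ} (hv0 : 0 ≤ v) (hv : v ≤ 1 / 2) :
    1 / (Real.pi * (1 - v)) ≤ (1 + 2 * v) / Real.pi := by
  have hπ := Real.pi_pos
  have h1v : 0 < 1 - v := by linarith
  rw [div_le_div_iff₀ (mul_pos hπ h1v) hπ]
  have key : 0 ≤ Real.pi * v * (1 - 2 * v) := mul_nonneg (mul_nonneg hπ.le hv0) (by linarith)
  have h : (1 + 2 * v) * (Real.pi * (1 - v)) = Real.pi + Real.pi * v * (1 - 2 * v) := by ring
  rw [h]
  linarith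

/-- The position of `m = ⌊δJ/(1+ε)⌋` relative to `δ`: `m/J ≤ δ` and `δ - m/J ≤ ε + 1/J`.
[cite: Teravainen2024, §5.4 (proof of Proposition 5.4, Case 2)] -/
theorem floor_mass_bounds {J : ℝ} (hJ : 0 < J) {ε δ : ℝ} (hε0 : 0 ≤ ε)
    (hδ1 : δ ≤ 1) {m : ℝ} (hm0 : 0 ≤ m) (hm1 : m ≤ δ / ((1 + ε) / J))
    (hm2 : δ / ((1 + ε) / J) < m + 1) :
    m / J ≤ δ ∧ δ - m / J ≤ ε + 1 / J := by
  have hε1 : 0 < 1 + ε := by linarith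
  have hs : δ / ((1 + ε) / J) = δ * J / (1 + ε) := by field_simp
  rw [hs] at hm1 hm2
  rw [le_div_iff₀ hε1] at hm1
  rw [div_lt_iff₀ hε1] at hm2
  constructor
  · rw [div_le_iff₀ hJ]
    nlinarith
  · have h : δ - m / J = (δ * J - m) / J := by field_simp
    rw [h, div_le_iff₀ hJ]
    have h2 : (ε + 1 / J) * J = ε * J + 1 := by field_simp
    rw [h2]
    -- `δ J - m < δ J - (δ J/(1+ε) - 1) = δ J ε/(1+ε) + 1 ≤ ε J + 1`
    have h3a : δ * (J * ε) ≤ 1 * (J * ε) := mul_le_mul_of_nonneg_right hδ1 (mul_nonneg hJ.le hε0)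
    have h3b : 0 ≤ J * ε * ε := by positivity
    have h3 : δ * J * ε ≤ ε * J * (1 + ε) := by
      have e1 : δ * J * ε = δ * (J * ε) := by ring
      have e2 : ε * J * (1 + ε) = 1 * (J * ε) + J * ε * ε := by ring
      rw [e1, e2]
      linarith
    have h4 : (δ * J - m) * (1 + ε) < (ε * J + 1) * (1 + ε) := by nlinarith
    exact (lt_of_mul_lt_mul_right h4 hε1.le).le

/-- The Lipschitz step: if `0 ≤ δ - t ≤ η` then `sin(πt) ≤ sin(πδ) + πη`. [folklore] -/
theorem sin_pi_mul_le_of_sub_le {t δ η : ℝ} (h0 : 0 ≤ δ - t) (h1 : δ - t ≤ η) :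
    Real.sin (Real.pi * t) ≤ Real.sin (Real.pi * δ) + Real.pi * η := by
  have hπ := Real.pi_pos
  have h := Real.abs_sin_sub_sin_le (Real.pi * t) (Real.pi * δ)
  have h2 : |Real.pi * t - Real.pi * δ| = Real.pi * (δ - t) := by
    rw [abs_sub_comm, abs_of_nonneg] <;> nlinarith
  rw [h2] at h
  have h3 := (abs_sub_le_iff.mp h).1
  nlinarith [mul_le_mul_of_nonneg_left h1 hπ.le]

/-- The bookkeeping of the error terms in §5.4: for `0 ≤ S ≤ 1/3`, `0 ≤ ε ≤ 1`,
`0 ≤ v ≤ y ≤ 1/4`: `(1+ε)(1+2v)(S + ε + y) + 2y ≤ S + 4ε + 8y`. [folklore] -/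
theorem endgame_bookkeeping {S ε v y : ℝ} (hS0 : 0 ≤ S) (hS1 : S ≤ 1 / 3) (hε0 : 0 ≤ ε)
    (hε1 : ε ≤ 1) (hv0 : 0 ≤ v) (hvy : v ≤ y) (hy : y ≤ 1 / 4) :
    (1 + ε) * (1 + 2 * v) * (S + ε + y) + 2 * y ≤ S + 4 * ε + 8 * y := by
  have hy0 : 0 ≤ y := hv0.trans hvy
  have hK : (1 + ε) * (1 + 2 * v) ≤ 1 + ε + 4 * v := by nlinarith
  have hK3 : 1 + ε + 4 * v ≤ 3 := by linarith
  have hsum0 : 0 ≤ S + ε + y := by linarith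
  have ha : (ε + 4 * v) * S ≤ (ε + 4 * v) * (1 / 3) := mul_le_mul_of_nonneg_left hS1 (by linarith)
  have hb : (1 + ε + 4 * v) * (ε + y) ≤ 3 * (ε + y) := mul_le_mul_of_nonneg_right hK3 (by linarith)
  calc (1 + ε) * (1 + 2 * v) * (S + ε + y) + 2 * y
      ≤ (1 + ε + 4 * v) * (S + ε + y) + 2 * y := by
        have := mul_le_mul_of_nonneg_right hK hsum0
        linarith
    _ = S + (ε + 4 * v) * S + (1 + ε + 4 * v) * (ε + y) + 2 * y := by ring
    _ ≤ S + (ε + 4 * v) * (1 / 3) + 3 * (ε + y) + 2 * y := by linarith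
    _ ≤ S + 4 * ε + 8 * y := by linarith

/-- **Teräväinen 2024, §5.4, the chain after (5.22)–(5.23)**, explicit form: for `J ≥ 4`,
`0 ≤ ε ≤ 1`, weights `0 ≤ α_j ≤ (1+ε)/J` (`j < J`) of total mass `δ = ∑_j α_j ≤ 1`,
`|∑_{j<J} α_j e(j/J)| ≤ sin(πδ)/π + 4ε + 8/J`. (Printed: `≤ (1+3η')sin(πδ_a)/π + O(η')` with
`ε = η'`, `J = J₀ = ⌊η'^{-1/(2C)}⌋`... i.e. `J₀ → ∞` as `η' → 0`.) [cite: Teravainen2024, §5.4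
(proof of Proposition 5.4, Case 2)] -/
theorem norm_sum_weight_mul_exp_le_sin {J : ℕ} (hJ : 4 ≤ J) {ε : ℝ} (hε0 : 0 ≤ ε) (hε1 : ε ≤ 1)
    (α : ℕ → ℝ) (h0 : ∀ j < J, 0 ≤ α j) (h1 : ∀ j < J, α j ≤ (1 + ε) / J)
    (hδ1 : ∑ j ∈ range J, α j ≤ 1) :
    ‖∑ j ∈ range J, (α j : ℂ) * exp (2 * Real.pi * I * (j : ℂ) / J)‖ ≤
      Real.sin (Real.pi * ∑ j ∈ range J, α j) / Real.pi + 4 * ε + 8 / J := by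
  have hJpos : 0 < J := by omega
  have hJ2 : 2 ≤ J := by omega
  have hJR : (4 : ℝ) ≤ J := by exact_mod_cast hJ
  have hJR0 : (0 : ℝ) < J := by linarith
  have hπ := Real.pi_pos
  have hπ4 := Real.pi_lt_four
  set δ : ℝ := ∑ j ∈ range J, α j with hδ
  have hδ0 : 0 ≤ δ := Finset.sum_nonneg fun j hj => h0 j (Finset.mem_range.mp hj)
  have hApos : 0 < (1 + ε) / J := by positivity
  have hs0 : 0 ≤ δ / ((1 + ε) / J) := div_nonneg hδ0 hApos.le
  obtain ⟨m, hm⟩ : ∃ m : ℕ, m = ⌊δ / ((1 + ε) / J)⌋₊ := ⟨_, rfl⟩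
  have hm1 : (m : ℝ) ≤ δ / ((1 + ε) / J) := by rw [hm]; exact Nat.floor_le hs0
  have hm2 : δ / ((1 + ε) / J) < m + 1 := by rw [hm]; exact Nat.lt_floor_add_one _
  -- Step 1: Lemma 5.7 with the fractional mass removed
  have hstep1 := norm_sum_weight_mul_exp_le_of_le hJpos hApos α h0 h1 hm1 hm2
  -- the position of `m`
  obtain ⟨hmδ1, hmδ2⟩ := floor_mass_bounds hJR0 hε0 hδ1 (Nat.cast_nonneg m) hm1 hm2
  have hmJ : m ≤ J := by
    have h : (m : ℝ) / J ≤ 1 := hmδ1.trans hδ1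
    rw [div_le_one hJR0] at h
    exact_mod_cast h
  -- Step 2: the closed form of the maximizer
  rw [norm_sum_range_exp_eq hJ2 hmJ] at hstep1
  -- Step 3: the denominator `J sin(π/J) ≥ π (1 - v)`, `v = π²/(6J²) ≤ 1/J ≤ 1/4`
  obtain ⟨v, hv⟩ : ∃ v : ℝ, v = Real.pi ^ 2 / (6 * (J : ℝ) ^ 2) := ⟨_, rfl⟩
  have hv0 : 0 ≤ v := by rw [hv]; positivity
  have hvJ : v ≤ 1 / J := by
    rw [hv, div_le_div_iff₀ (by positivity) hJR0]
    have hπ2 : Real.pi ^ 2 ≤ 16 := by nlinarith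
    have h16 : (16 : ℝ) * J ≤ 6 * (J : ℝ) ^ 2 := by nlinarith
    nlinarith
  have hy4 : (1 : ℝ) / J ≤ 1 / 4 := by
    rw [div_le_div_iff₀ hJR0 (by norm_num)]
    linarith
  have hden : Real.pi * (1 - v) ≤ J * Real.sin (Real.pi / J) := by
    have h := pi_sub_le_mul_sin_pi_div hJpos
    have h2 : Real.pi * (1 - v) = Real.pi - Real.pi ^ 3 / (6 * (J : ℝ) ^ 2) := by
      rw [hv]
      ring
    rw [h2]
    exact h
  have hden_pos : 0 < Real.pi * (1 - v) := mul_pos hπ (by linarith)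
  -- Step 4: the numerator
  have hsin_m : Real.sin (Real.pi * m / J) ≤ Real.sin (Real.pi * δ) + Real.pi * (ε + 1 / J) := by
    have h := sin_pi_mul_le_of_sub_le (t := (m : ℝ) / J) (by linarith) hmδ2
    rw [mul_div_assoc]
    exact h
  have hsin_m0 : 0 ≤ Real.sin (Real.pi * m / J) := by
    apply Real.sin_nonneg_of_nonneg_of_le_pi (by positivity)
    have h : (m : ℝ) / J ≤ 1 := by rw [div_le_one hJR0]; exact_mod_cast hmJ
    calc Real.pi * m / J = Real.pi * (m / J) := by ring
      _ ≤ Real.pi * 1 := mul_le_mul_of_nonneg_left h hπ.le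
      _ = Real.pi := mul_one _
  -- Step 5: the main term
  have hS1 : Real.sin (Real.pi * δ) / Real.pi ≤ 1 / 3 := by
    rw [div_le_div_iff₀ hπ (by norm_num)]
    have := Real.sin_le_one (Real.pi * δ)
    nlinarith [Real.pi_gt_three]
  have hsinδ0 : 0 ≤ Real.sin (Real.pi * δ) :=
    Real.sin_nonneg_of_nonneg_of_le_pi (by positivity) (by nlinarith)
  have hS0 : 0 ≤ Real.sin (Real.pi * δ) / Real.pi := div_nonneg hsinδ0 hπ.le
  have hT : (1 + ε) / J * (Real.sin (Real.pi * m / J) / Real.sin (Real.pi / J)) ≤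
      (1 + ε) * (1 + 2 * v) * (Real.sin (Real.pi * δ) / Real.pi + ε + 1 / J) := by
    have h1' : (1 + ε) / J * (Real.sin (Real.pi * m / J) / Real.sin (Real.pi / J)) =
        (1 + ε) * (Real.sin (Real.pi * m / J) * (1 / (J * Real.sin (Real.pi / J)))) := by
      field_simp
    rw [h1']
    have h2' : 1 / (J * Real.sin (Real.pi / J)) ≤ 1 / (Real.pi * (1 - v)) :=
      one_div_le_one_div_of_le hden_pos hden
    have h3' : 1 / (Real.pi * (1 - v)) ≤ (1 + 2 * v) / Real.pi :=
      one_div_pi_mul_one_sub_le hv0 (by linarith)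
    have h4' : Real.sin (Real.pi * m / J) * (1 / (J * Real.sin (Real.pi / J))) ≤
        (Real.sin (Real.pi * δ) + Real.pi * (ε + 1 / J)) * ((1 + 2 * v) / Real.pi) :=
      mul_le_mul hsin_m (h2'.trans h3') (one_div_pos.mpr (hden_pos.trans_le hden)).le
        (add_nonneg hsinδ0 (by positivity))
    have h5' : (Real.sin (Real.pi * δ) + Real.pi * (ε + 1 / J)) * ((1 + 2 * v) / Real.pi) =
        (1 + 2 * v) * (Real.sin (Real.pi * δ) / Real.pi + ε + 1 / J) := by
      field_simp
      ring
    rw [h5'] at h4'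
    calc (1 + ε) * (Real.sin (Real.pi * m / J) * (1 / (J * Real.sin (Real.pi / J))))
        ≤ (1 + ε) * ((1 + 2 * v) * (Real.sin (Real.pi * δ) / Real.pi + ε + 1 / J)) :=
          mul_le_mul_of_nonneg_left h4' (by linarith)
      _ = (1 + ε) * (1 + 2 * v) * (Real.sin (Real.pi * δ) / Real.pi + ε + 1 / J) := by ring
  -- Step 6: bookkeeping
  have hA2 : (1 + ε) / J ≤ 2 * (1 / J) := by
    rw [div_eq_mul_one_div]
    nlinarith [show (0 : ℝ) < 1 / J by positivity]
  have hbook := endgame_bookkeeping hS0 hS1 hε0 hε1 hv0 hvJ hy4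
  calc ‖∑ j ∈ range J, (α j : ℂ) * exp (2 * Real.pi * I * (j : ℂ) / J)‖
      ≤ (1 + ε) / J * (Real.sin (Real.pi * m / J) / Real.sin (Real.pi / J)) + (1 + ε) / J :=
        hstep1
    _ ≤ (1 + ε) * (1 + 2 * v) * (Real.sin (Real.pi * δ) / Real.pi + ε + 1 / J) + 2 * (1 / J) :=
        add_le_add hT hA2
    _ ≤ Real.sin (Real.pi * δ) / Real.pi + 4 * ε + 8 * (1 / J) := hbook
    _ = Real.sin (Real.pi * δ) / Real.pi + 4 * ε + 8 / J := by ring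

end Teravainen2024

end Literature.NumberTheory.Sieve
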